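import Summits.KontsevichZagierPeriods.KontsevichZagierPeriods.Theorems.LinRedNormalFormArrangementNormalFormSeparateThreeHHKRay
import Summits.KontsevichZagierPeriods.KontsevichZagierPeriods.Theorems.LinRedNormalFormArrangementNormalFormSeparateThreeHHKForms
import Summits.KontsevichZagierPeriods.KontsevichZagierPeriods.Theorems.LinRedNormalFormArrangementNormalFormSeparateThreeHHKSign
import Summits.KontsevichZagierPeriods.KontsevichZagierPeriods.Theorems.LinRedNormalFormArrangementNormalFormSeparateTwoHIPole

/-!
# The sector theorems: scales, the base polyhedron along a sector, orders of the numerator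

(Line `janus-bands`, crux `ArrangementNormalForm`, stub `stub_separateHigh`, part `HHKSecPrep` of
the wall-invariant termwise-split lemma `separateThree_hHk` in base dimension `3` with fibres.)
Preparations shared by the sector theorems at a base point `z₁ ∈ ℝ³`:
* SCALES: triply-eventual statements in `(δt, δ, ε)` pulled back along `· ↦ 4 ·`
  (`eventually_four3`) and extraction of one common scale from four of them
  (`exists_of_eventually₄3`);
* THE BASE POLYHEDRON ALONG A SECTOR: `Y = {∀ j, 0 < φ j}` for finitely many real affine forms;
  every form has a nested affine value along the sector (`rav_npt`), so by the sign lemma of part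
  `HHKSign` every small nested sector at scale `(4δt, 4δ, 4ε)` lies inside `Y` or misses it
  (`eventually_in_or_out3`, registered as `separateThreeHHK_secPrep`); a sector inside `Y`
  accumulates at the open ray `z₁ + t d`, which therefore lies in `closure Y`
  (`ray_mem_closure`) — the entry point of the wall invariant `hH`;
* ORDERS: the minimal total degree `a₀` of non-zero Taylor data (`exists_order3`) and the
  resulting bounds for the graded rows.
-/

noncomputable section

open Set MeasureTheory Filter Topology
open scoped ENNReal

namespace Summit.KontsevichZagierPeriods.ArrangementNormalForm.JanusBands

namespace SepHHK

open SepTwo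

/-! ### Scales -/

/-- Multiplication by `4` preserves `𝓝[>] 0`. -/
theorem tendsto_four : Tendsto (fun δ : ℝ => 4 * δ) (𝓝[>] 0) (𝓝[>] 0) := by
  refine tendsto_nhdsWithin_iff.2 ⟨?_, ?_⟩
  · exact ((continuous_const.mul continuous_id).tendsto' 0 0 (by simp)).mono_left
      nhdsWithin_le_nhds
  · filter_upwards [self_mem_nhdsWithin] with δ hδ
    exact mem_Ioi.2 (by have := mem_Ioi.1 hδ; positivity)

/-- Pulling back a triply-eventual statement along `· ↦ 4 ·`. -/
theorem eventually_four3 {P : ℝ → ℝ → ℝ → Prop}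
    (h : ∀ᶠ δt in 𝓝[>] (0 : ℝ), ∀ᶠ δ in 𝓝[>] (0 : ℝ), ∀ᶠ ε in 𝓝[>] (0 : ℝ), P δt δ ε) :
    ∀ᶠ δt in 𝓝[>] (0 : ℝ), ∀ᶠ δ in 𝓝[>] (0 : ℝ), ∀ᶠ ε in 𝓝[>] (0 : ℝ),
      P (4 * δt) (4 * δ) (4 * ε) :=
  tendsto_four.eventually (h.mono fun _ hδt =>
    tendsto_four.eventually (hδt.mono fun _ hδ => tendsto_four.eventually hδ))

/-- Extracting one scale from four triply-eventual statements. -/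
theorem exists_of_eventually₄3 {A B C D : ℝ → ℝ → ℝ → Prop}
    (hA : ∀ᶠ δt in 𝓝[>] (0 : ℝ), ∀ᶠ δ in 𝓝[>] (0 : ℝ), ∀ᶠ ε in 𝓝[>] (0 : ℝ), A δt δ ε)
    (hB : ∀ᶠ δt in 𝓝[>] (0 : ℝ), ∀ᶠ δ in 𝓝[>] (0 : ℝ), ∀ᶠ ε in 𝓝[>] (0 : ℝ), B δt δ ε)
    (hC : ∀ᶠ δt in 𝓝[>] (0 : ℝ), ∀ᶠ δ in 𝓝[>] (0 : ℝ), ∀ᶠ ε in 𝓝[>] (0 : ℝ), C δt δ ε)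
    (hD : ∀ᶠ δt in 𝓝[>] (0 : ℝ), ∀ᶠ δ in 𝓝[>] (0 : ℝ), ∀ᶠ ε in 𝓝[>] (0 : ℝ), D δt δ ε) :
    ∃ δt > 0, ∃ δ > 0, ∃ ε > 0, A δt δ ε ∧ B δt δ ε ∧ C δt δ ε ∧ D δt δ ε := by
  obtain ⟨δt, hδt0, ⟨hA', hB'⟩, hC', hD'⟩ :=
    ((eventually_mem_nhdsWithin (a := (0 : ℝ)) (s := Ioi 0)).and ((hA.and hB).and (hC.and hD))).exists
  obtain ⟨δ, hδ0, ⟨hA'', hB''⟩, hC'', hD''⟩ :=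
    ((eventually_mem_nhdsWithin (a := (0 : ℝ)) (s := Ioi 0)).and ((hA'.and hB').and (hC'.and hD'))).exists
  obtain ⟨ε, hε0, ⟨hA''', hB'''⟩, hC''', hD'''⟩ :=
    ((eventually_mem_nhdsWithin (a := (0 : ℝ)) (s := Ioi 0)).and
      ((hA''.and hB'').and (hC''.and hD''))).exists
  exact ⟨δt, mem_Ioi.1 hδt0, δ, mem_Ioi.1 hδ0, ε, mem_Ioi.1 hε0, hA''', hB''', hC''', hD'''⟩

/-! ### The base polyhedron along a sector -/

/-- The value of a real affine form at a base point. -/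
def rav (x : Fin 3 → ℝ) (f : (Fin 3 → ℝ) × ℝ) : ℝ := (∑ i, f.1 i * x i) + f.2

/-- The linear part of a real affine form. -/
def flin (f : (Fin 3 → ℝ) × ℝ) (y : Fin 3 → ℝ) : ℝ := ∑ i, f.1 i * y i

/-- Real affine forms along a nested sector. -/
theorem rav_npt (z₁ d Q S : Fin 3 → ℝ) (t v u : ℝ) (f : (Fin 3 → ℝ) × ℝ) :
    rav (npt z₁ d Q S t v u) f = rav z₁ f + t * (flin f d + v * (flin f Q + u * flin f S)) := by
  simp only [rav, flin, npt, Fin.sum_univ_three]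
  ring

/-- Real affine forms are continuous. -/
theorem continuous_rav (f : (Fin 3 → ℝ) × ℝ) : Continuous fun x => rav x f := by
  unfold rav; fun_prop

/-- The base polyhedron is measurable (it is open). -/
theorem measurableSet_Y3 {m'' : ℕ} (φ : Fin m'' → (Fin 3 → ℝ) × ℝ) :
    MeasurableSet {x : Fin 3 → ℝ | ∀ j, 0 < rav x (φ j)} := by
  have : {x : Fin 3 → ℝ | ∀ j, 0 < rav x (φ j)} = ⋂ j, {x | 0 < rav x (φ j)} := by ext x; simp
  rw [this]
  exact MeasurableSet.iInter fun j => measurableSet_lt measurable_const (continuous_rav _).measurable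

/-- **The sign lemma along a nested sector:** for all small scales the open nested sector at scale
`(4δt, 4δ, 4ε)` lies inside the base polyhedron or misses it. -/
theorem eventually_in_or_out3 {m'' : ℕ} (φ : Fin m'' → (Fin 3 → ℝ) × ℝ) (z₁ d Q S : Fin 3 → ℝ) :
    ∀ᶠ δt in 𝓝[>] (0 : ℝ), ∀ᶠ δ in 𝓝[>] (0 : ℝ), ∀ᶠ ε in 𝓝[>] (0 : ℝ),
      (∀ t ∈ Ioo (0 : ℝ) (4 * δt), ∀ v ∈ Ioo (0 : ℝ) (4 * δ), ∀ u ∈ Ioo (0 : ℝ) (4 * ε),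
          npt z₁ d Q S t v u ∈ {x : Fin 3 → ℝ | ∀ j, 0 < rav x (φ j)}) ∨
        (∀ t ∈ Ioo (0 : ℝ) (4 * δt), ∀ v ∈ Ioo (0 : ℝ) (4 * δ), ∀ u ∈ Ioo (0 : ℝ) (4 * ε),
          npt z₁ d Q S t v u ∉ {x : Fin 3 → ℝ | ∀ j, 0 < rav x (φ j)}) := by
  have h := eventually_four3 (eventually_sign3 (fun j => rav z₁ (φ j)) (fun j => flin (φ j) d)
    (fun j => flin (φ j) Q) (fun j => flin (φ j) S))
  refine h.mono fun δt hδt => hδt.mono fun δ hδ => hδ.mono fun ε hε => ?_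
  rcases hε with hpos | ⟨j, hj⟩
  · refine Or.inl fun t ht v hv u hu j => ?_
    show 0 < rav (npt z₁ d Q S t v u) (φ j)
    rw [rav_npt]
    exact hpos t ht v hv u hu j
  · refine Or.inr fun t ht v hv u hu hmem => ?_
    have h1 : 0 < rav (npt z₁ d Q S t v u) (φ j) := hmem j
    rw [rav_npt] at h1
    linarith [hj t ht v hv u hu]

/-- **The open ray lies in the closure of a sector inside the base.** If the open nested sector at
scale `(δt, δ, ε)` lies inside `Y`, then `z₁ + t d ∈ closure Y` for every `t ∈ (0, δt)`. -/
theorem ray_mem_closure (Y : Set (Fin 3 → ℝ)) (z₁ d Q S : Fin 3 → ℝ) {δt δ ε : ℝ} (hδ : 0 < δ)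
    (hε : 0 < ε)
    (hin : ∀ t ∈ Ioo (0 : ℝ) δt, ∀ v ∈ Ioo (0 : ℝ) δ, ∀ u ∈ Ioo (0 : ℝ) ε, npt z₁ d Q S t v u ∈ Y)
    {t : ℝ} (ht : t ∈ Ioo (0 : ℝ) δt) : z₁ + t • d ∈ closure Y := by
  have hcont : Continuous fun v : ℝ => npt z₁ d Q S t v (ε / 2) :=
    continuous_pi fun k => by simp only [npt]; fun_prop
  have hlim : Tendsto (fun v : ℝ => npt z₁ d Q S t v (ε / 2)) (𝓝[>] 0) (𝓝 (z₁ + t • d)) := by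
    have h0 : npt z₁ d Q S t 0 (ε / 2) = z₁ + t • d := by
      funext k; simp [npt]
    rw [← h0]
    exact (hcont.tendsto 0).mono_left nhdsWithin_le_nhds
  refine mem_closure_of_tendsto hlim ?_
  filter_upwards [Ioo_mem_nhdsGT hδ] with v hv
  exact hin t ht v hv (ε / 2) ⟨by linarith, by linarith⟩

/-! ### Orders of the numerator -/

variable {D : ℕ}

/-- **The minimal total degree of non-zero Taylor data.** -/
theorem exists_order3 (c : Coef₃ D) (hc : c ≠ 0) :
    ∃ a₀ : ℕ, a₀ < 3 * D + 1 ∧ crow c a₀ ≠ 0 ∧ ∀ a < a₀, crow c a = 0 := by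
  classical
  set T := (Finset.univ.filter fun x : Fin (D + 1) × Fin (D + 1) × Fin (D + 1) =>
    c x.1 x.2.1 x.2.2 ≠ 0).image fun x => tdeg3 x.1 x.2.1 x.2.2 with hT
  have hTne : T.Nonempty := by
    by_contra h
    rw [Finset.not_nonempty_iff_eq_empty, Finset.image_eq_empty, Finset.filter_eq_empty_iff] at h
    apply hc
    funext i m₁ m₂
    have := h (x := (i, m₁, m₂)) (Finset.mem_univ _)
    simpa using this
  refine ⟨T.min' hTne, ?_, ?_, ?_⟩
  · obtain ⟨x, -, hx⟩ := Finset.mem_image.1 (T.min'_mem hTne)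
    rw [← hx]; exact tdeg3_lt _ _ _
  · obtain ⟨x, hx, hxd⟩ := Finset.mem_image.1 (T.min'_mem hTne)
    have hcx : c x.1 x.2.1 x.2.2 ≠ 0 := (Finset.mem_filter.1 hx).2
    intro h0
    have := congr_fun (congr_fun (congr_fun h0 x.1) x.2.1) x.2.2
    simp only [crow, hxd, if_true] at this
    exact hcx this
  · intro a ha
    funext i m₁ m₂
    simp only [crow]
    split_ifs with h
    · by_contra hne
      have hmem : tdeg3 i m₁ m₂ ∈ T := Finset.mem_image.2 ⟨(i, m₁, m₂),
        Finset.mem_filter.2 ⟨Finset.mem_univ _, hne⟩, rfl⟩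
      have := T.min'_le _ hmem
      omega
    · rfl

/-- Rows below the order vanish, termwise for the pieces. -/
theorem Fpc_crow_eq_zero_of_lt (l₁ l₂ : ℝ) (c : Coef₃ D) {a₀ : ℕ} (hlow : ∀ a < a₀, crow c a = 0)
    (a : Fin (3 * D + 1)) (ha : (a : ℕ) < a₀) (i : Fin (D + 1)) (ξ : Fin 3 → ℝ) :
    Fpc l₁ l₂ (crow c a) i ξ = 0 := by
  rw [hlow a ha]
  unfold Fpc nterm
  simp

/-- **The pieces are `O(t^{a₀})` along the sector.** -/
theorem abs_Fpc_smul_le (l₁ l₂ : ℝ) (c : Coef₃ D) {a₀ : ℕ} (hlow : ∀ a < a₀, crow c a = 0)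
    (i : Fin (D + 1)) (ξ : Fin 3 → ℝ) {B : ℝ}
    (hB : ∀ a : Fin (3 * D + 1), |Fpc l₁ l₂ (crow c a) i ξ| ≤ B) {t : ℝ} (ht0 : 0 ≤ t) (ht1 : t ≤ 1) :
    |Fpc l₁ l₂ c i (t • ξ)| ≤ (3 * D + 1) * B * t ^ a₀ := by
  rw [Fpc_smul_pev]
  have h := abs_pev_le_of_low_zero (fun a : Fin (3 * D + 1) => Fpc l₁ l₂ (crow c a) i ξ) a₀
    (fun a ha => Fpc_crow_eq_zero_of_lt l₁ l₂ c hlow a ha i ξ) hB ht0 ht1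
  push_cast at h ⊢
  linarith [h]

end SepHHK

/-- **The sign lemma along a nested thin sector** (registered part of `stub_separateHigh`, base
dimension `3` with fibres; literal form of `SepHHK.eventually_in_or_out3`): for finitely many real
affine forms `φ j` on `ℝ³` and a nested sector at `z₁` with frame `d, Q, S`, for all small `δt`,
all small `δ`, all small `ε`, the open nested sector at scale `(4δt, 4δ, 4ε)` lies inside the open
polyhedron `{∀ j, 0 < φ j}` or misses it. -/
theorem separateThreeHHK_secPrep (m'' : ℕ) (φ : Fin m'' → (Fin 3 → ℝ) × ℝ) (z₁ d Q S : Fin 3 → ℝ) : ∀ᶠ δt in nhdsWithin (0 : ℝ) (Set.Ioi 0), ∀ᶠ δ in nhdsWithin (0 : ℝ) (Set.Ioi 0), ∀ᶠ ε in nhdsWithin (0 : ℝ) (Set.Ioi 0), (∀ t ∈ Set.Ioo (0 : ℝ) (4 * δt), ∀ v ∈ Set.Ioo (0 : ℝ) (4 * δ), ∀ u ∈ Set.Ioo (0 : ℝ) (4 * ε), (fun i => z₁ i + t * (d i + v * (Q i + u * S i))) ∈ {x : Fin 3 → ℝ | ∀ j, 0 < (∑ i, (φ j).1 i * x i) + (φ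 j).2}) ∨ (∀ t ∈ Set.Ioo (0 : ℝ) (4 * δt), ∀ v ∈ Set.Ioo (0 : ℝ) (4 * δ), ∀ u ∈ Set.Ioo (0 : ℝ) (4 * ε), (fun i => z₁ i + t * (d i + v * (Q i + u * S i))) ∉ {x : Fin 3 → ℝ | ∀ j, 0 < (∑ i, (φ j).1 i * x i) + (φ j).2}) := by
  exact SepHHK.eventually_in_or_out3 φ z₁ d Q S

end Summit.KontsevichZagierPeriods.ArrangementNormalForm.JanusBands
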